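import Mathlib
import Literature.AlgebraicGeometry.Resolution.TameQuotientSingularitiesResolution
import Literature.AlgebraicGeometry.Resolution.LogRegularAtlas
import Literature.AlgebraicGeometry.Resolution.MarkedIdeals

/-!
# Crux `CleanModelsSuffice` (stmt-ResolutionOfSingularities-15883) — ideator 2, round 1: first lemmas

Two idea cards, one first lemma each (signatures only; `sorry` bodies):

* `kummer-chart-bergh-rydh` — `kummerRoot_smooth` (ring-level core) and `CleanChartsBR` (the
  stub-shaped statement: a pointwise log-clean regular `V` over a PERFECT field makes its
  normalisation in `L` satisfy, point by point, the étale-local graded-smooth-quotient hypothesis of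
  the vendored `BerghRydh2019_diagonalizableQuotientResolution`).
* `exceptionalise-then-kato` — `ExceptionallyCleanAtlas` (an exceptionally-bounded clean model
  carries a Kato log-regular Zariski atlas on its normalisation, so the vendored
  `Kato1994_logRegular_hasResolution_general` applies).
-/

noncomputable section

set_option linter.dupNamespace false

open CategoryTheory AlgebraicGeometry Polynomial
open Literature.AlgebraicGeometry.Resolution

namespace Summit.ResolutionOfSingularities.ResolutionOfSingularities.Cruxes.CleanModelsSuffice.Ideator2

/-! ## Card `kummer-chart-bergh-rydh` -/

/-- **Kummer root of an étale coordinate is smooth.** If `R` is étale over the polynomial ring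
`k[T_0, …, T_d]` then `R[u]/(u^p - T_0)` is smooth over `k` (it is étale over
`k[u, T_1, …, T_d]`, `T_0 = u^p`). Iterated over the boundary coordinates `t_1, …, t_m` of a clean
toroidal chart this gives the smooth `(ℤ/p)^m`-graded Kummer algebra `S = 𝒪(U')[t^{1/p}]` whose
`μ_p^{m-1}`-invariants are the normalisation of `U'` in `L`. [folklore] -/
theorem kummerRoot_smooth (p : ℕ) [Fact p.Prime] (k : Type) [Field k] [CharP k p] (d : ℕ)
    (R : Type) [CommRing R] [Algebra k R] [Algebra (MvPolynomial (Fin (d + 1)) k) R]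
    [IsScalarTower k (MvPolynomial (Fin (d + 1)) k) R]
    [Algebra.Etale (MvPolynomial (Fin (d + 1)) k) R] :
    Algebra.Smooth k (AdjoinRoot ((X : R[X]) ^ p -
      C (algebraMap (MvPolynomial (Fin (d + 1)) k) R (MvPolynomial.X 0)))) := by
  sorry

/-- **Pointwise log-clean ⇒ Bergh–Rydh charts (perfect ground field).** For `k` perfect of
characteristic `p`, `V` regular integral separated of finite type over `k`, `L/K(V)` purely
inseparable of degree `p`, and a log-clean presentation at every point of `V` (the clause of
`RadicialJung.CleanModels` with `π = 𝟙`), every point of the normalisation `V^L` of `V` in `L`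
lies in the image of an étale `k`-morphism from `Spec S₀`, `S` a smooth finitely generated
`k`-algebra graded by a finite abelian group with degree-zero part `S₀` — the hypothesis of
`BerghRydh2019_diagonalizableQuotientResolution` for `X = V^L`. (Chart at a toroidal point:
`S = 𝒪(U')[u_1,…,u_m]/(u_i^p - t_i)` on an affine `U' ∋ v` étale over `𝔸^d` by `(t_i)`, graded by
`A = (ℤ/p)^m/⟨a⟩`; at regular-type and `m = 1` points `V^L` is regular, `A = 0`.) [folklore] -/
def CleanChartsBR : Prop :=
  ∀ p : ℕ, p.Prime → ∀ (k : Type) [Field k] [CharP k p] [PerfectField k]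
    (V : Scheme.{0}) [IsIntegral V] (f : V ⟶ Spec (.of k)) (L : Type) [Field L]
    [Algebra V.functionField L],
    IsSeparated f → LocallyOfFiniteType f → QuasiCompact f → Scheme.IsRegular V →
    IsPurelyInseparable V.functionField L → Module.finrank V.functionField L = p →
    (∀ v : V, ∃ (y : L) (g : V.functionField), y ∉ Set.range (algebraMap V.functionField L) ∧
      algebraMap V.functionField L g = y ^ p ∧
      ((∃ (d m : ℕ) (hmd : m ≤ d) (t : Fin d → V.presheaf.stalk v) (a : Fin m → ℕ),
          Ideal.span (Set.range t) = IsLocalRing.maximalIdeal (V.presheaf.stalk v) ∧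
          ringKrullDim (V.presheaf.stalk v) = (d : WithBot ℕ∞) ∧ 0 < m ∧ (∀ i, ¬ p ∣ a i) ∧
          g = ∏ i : Fin m, (algebraMap (V.presheaf.stalk v) V.functionField
            (t (Fin.castLE hmd i))) ^ (a i)) ∨
       (∃ u₀ : V.presheaf.stalk v, IsUnit u₀ ∧
          g = algebraMap (V.presheaf.stalk v) V.functionField u₀ ∧
          ((∀ c : V.presheaf.stalk v, u₀ - c ^ p ∉ IsLocalRing.maximalIdeal (V.presheaf.stalk v)) ∨
           (∃ c : V.presheaf.stalk v, u₀ - c ^ p ∈ IsLocalRing.maximalIdeal (V.presheaf.stalk v) ∧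
              u₀ - c ^ p ∉ IsLocalRing.maximalIdeal (V.presheaf.stalk v) ^ 2))))) →
    let ν := Spec.map (CommRingCat.ofHom (algebraMap V.functionField L)) ≫
      V.fromSpecStalk (genericPoint V)
    ∀ x : ν.normalization, ∃ (A : Type) (_ : AddCommGroup A) (_ : Finite A) (_ : DecidableEq A)
        (S : Type) (_ : CommRing S) (_ : Algebra k S) (𝒮 : A → Submodule k S)
        (_ : GradedAlgebra 𝒮), Algebra.FiniteType k S ∧ Algebra.Smooth k S ∧
        ∃ φ : Spec (.of (𝒮 0)) ⟶ ν.normalization, Etale φ ∧ x ∈ Set.range φ ∧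
          φ ≫ ν.fromNormalization ≫ f = Spec.map (CommRingCat.ofHom (algebraMap k (𝒮 0)))

/-- The card's endgame over perfect fields is then one line: the vendored Bergh–Rydh fact
resolves the normalisation. (Integrality/separatedness/finite type of `V^L` over `k` are the
prover's bookkeeping; stated here as hypotheses.) [cite: BerghRydh2019, Thm 5] -/
theorem hasResolution_normalization_of_cleanChartsBR
    (hBR : BerghRydh2019_diagonalizableQuotientResolution) (hC : CleanChartsBR)
    (p : ℕ) (hp : p.Prime) (k : Type) [Field k] [CharP k p] [PerfectField k]
    (V : Scheme.{0}) [IsIntegral V] (f : V ⟶ Spec (.of k)) (L : Type) [Field L]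
    [Algebra V.functionField L] [IsSeparated f] [LocallyOfFiniteType f] [QuasiCompact f]
    (hV : Scheme.IsRegular V) (hL : IsPurelyInseparable V.functionField L)
    (hdeg : Module.finrank V.functionField L = p)
    (hclean : ∀ v : V, ∃ (y : L) (g : V.functionField),
      y ∉ Set.range (algebraMap V.functionField L) ∧ algebraMap V.functionField L g = y ^ p ∧
      ((∃ (d m : ℕ) (hmd : m ≤ d) (t : Fin d → V.presheaf.stalk v) (a : Fin m → ℕ),
          Ideal.span (Set.range t) = IsLocalRing.maximalIdeal (V.presheaf.stalk v) ∧
          ringKrullDim (V.presheaf.stalk v) = (d : WithBot ℕ∞) ∧ 0 < m ∧ (∀ i, ¬ p ∣ a i) ∧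
          g = ∏ i : Fin m, (algebraMap (V.presheaf.stalk v) V.functionField
            (t (Fin.castLE hmd i))) ^ (a i)) ∨
       (∃ u₀ : V.presheaf.stalk v, IsUnit u₀ ∧
          g = algebraMap (V.presheaf.stalk v) V.functionField u₀ ∧
          ((∀ c : V.presheaf.stalk v, u₀ - c ^ p ∉ IsLocalRing.maximalIdeal (V.presheaf.stalk v)) ∨
           (∃ c : V.presheaf.stalk v, u₀ - c ^ p ∈ IsLocalRing.maximalIdeal (V.presheaf.stalk v) ∧
              u₀ - c ^ p ∉ IsLocalRing.maximalIdeal (V.presheaf.stalk v) ^ 2)))))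
    [IsIntegral (Spec.map (CommRingCat.ofHom (algebraMap V.functionField L)) ≫
      V.fromSpecStalk (genericPoint V)).normalization]
    [IsSeparated ((Spec.map (CommRingCat.ofHom (algebraMap V.functionField L)) ≫
      V.fromSpecStalk (genericPoint V)).fromNormalization ≫ f)]
    [LocallyOfFiniteType ((Spec.map (CommRingCat.ofHom (algebraMap V.functionField L)) ≫
      V.fromSpecStalk (genericPoint V)).fromNormalization ≫ f)]
    [QuasiCompact ((Spec.map (CommRingCat.ofHom (algebraMap V.functionField L)) ≫
      V.fromSpecStalk (genericPoint V)).fromNormalization ≫ f)] :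
    Scheme.HasResolution (Spec.map (CommRingCat.ofHom (algebraMap V.functionField L)) ≫
      V.fromSpecStalk (genericPoint V)).normalization := by
  refine hBR k _ (((Spec.map (CommRingCat.ofHom (algebraMap V.functionField L)) ≫
      V.fromSpecStalk (genericPoint V)).fromNormalization ≫ f)) ?_
  intro x
  obtain ⟨A, _, _, _, S, _, _, 𝒮, _, hft, hsm, φ, hφ, hx, hcomp⟩ :=
    hC p hp k V f L ‹_› ‹_› ‹_› hV hL hdeg hclean x
  exact ⟨A, _, ‹_›, ‹_›, S, _, _, 𝒮, ‹_›, hft, hsm, φ, hφ, hx, by simpa [Category.assoc] using hcomp⟩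

/-! ## Card `exceptionalise-then-kato` -/

/-- **An exceptionally-bounded clean model carries a Kato log-regular Zariski atlas on its
normalisation.** `V` regular integral (any ground field — Kato's theory is absolute), `E` a list of
ideal sheaves with simple normal crossings (the total exceptional divisor of the exceptionalisation
game), `L/K(V)` purely inseparable of degree `p`; at every `v` a clean presentation ADAPTED to `E`
(the members of `E` through `v` are coordinate hyperplanes of the regular system `t`) whose charged
(exponent prime to `p`) components are either a single one (`m = 1`) or all members of `E`, and at
regular-type points the transversal parameter `u₀ - c^p` is a coordinate not cut out by `E`. Then
the normalisation `V^L` carries a `LogRegularAtlas` (the divisorial log structure of the preimage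
of `E`: toric Kummer charts `𝒪 ⊗_{ℤ[ℕ^r]} ℤ[Q]`, `Q = (ℤ^r + ℤ·a/p) ∩ ℝ^r_{≥ 0}`, at toroidal points,
coordinate charts `ℕ^r` at regular points), hence a resolution by
`Kato1994_logRegular_hasResolution_general`. [cite: Kato1994, (10.4); Niziol2006, Thm 5.8] -/
def ExceptionallyCleanAtlas : Prop :=
  ∀ p : ℕ, p.Prime → ∀ (V : Scheme.{0}) [IsIntegral V] [IsNoetherian V] (_ : CharP V.functionField p)
    (E : List V.IdealSheafData) (L : Type) [Field L] [Algebra V.functionField L],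
    Scheme.IsRegular V → HasSNC E →
    IsPurelyInseparable V.functionField L → Module.finrank V.functionField L = p →
    (∀ v : V, ∃ (y : L) (g : V.functionField) (d : ℕ) (t : Fin d → V.presheaf.stalk v),
      y ∉ Set.range (algebraMap V.functionField L) ∧ algebraMap V.functionField L g = y ^ p ∧
      Ideal.span (Set.range t) = IsLocalRing.maximalIdeal (V.presheaf.stalk v) ∧
      ringKrullDim (V.presheaf.stalk v) = (d : WithBot ℕ∞) ∧
      -- `t` is adapted to `E`: every member of `E` through `v` is a coordinate hyperplane
      (∀ D ∈ E, v ∈ D.support → ∃ j, stalkIdeal D v = Ideal.span {t j}) ∧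
      ((∃ (m : ℕ) (hmd : m ≤ d) (a : Fin m → ℕ), 0 < m ∧ (∀ i, ¬ p ∣ a i) ∧
          g = ∏ i : Fin m, (algebraMap (V.presheaf.stalk v) V.functionField
            (t (Fin.castLE hmd i))) ^ (a i) ∧
          -- exceptionally bounded: one charged component, or all charged components exceptional
          (m = 1 ∨ ∀ i : Fin m, ∃ D ∈ E, stalkIdeal D v = Ideal.span {t (Fin.castLE hmd i)})) ∨
       (∃ u₀ : V.presheaf.stalk v, IsUnit u₀ ∧
          g = algebraMap (V.presheaf.stalk v) V.functionField u₀ ∧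
          ((∀ c : V.presheaf.stalk v, u₀ - c ^ p ∉ IsLocalRing.maximalIdeal (V.presheaf.stalk v)) ∨
           (∃ (c : V.presheaf.stalk v) (j₀ : Fin d), u₀ - c ^ p = t j₀ ∧
              ∀ D ∈ E, stalkIdeal D v ≠ Ideal.span {t j₀}))))) →
    Nonempty (LogRegularAtlas
      (Spec.map (CommRingCat.ofHom (algebraMap V.functionField L)) ≫
        V.fromSpecStalk (genericPoint V)).normalization)

/-- Endgame of the card (one line from the vendored Kato fact). [cite: Kato1994, (10.4)] -/
theorem hasResolution_of_exceptionallyCleanAtlas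
    (hK : Kato1994_logRegular_hasResolution_general.{0}) (hA : ExceptionallyCleanAtlas)
    (p : ℕ) (hp : p.Prime) (V : Scheme.{0}) [IsIntegral V] [IsNoetherian V]
    (hchar : CharP V.functionField p) (E : List V.IdealSheafData) (L : Type) [Field L]
    [Algebra V.functionField L] (hV : Scheme.IsRegular V) (hE : HasSNC E)
    (hL : IsPurelyInseparable V.functionField L) (hdeg : Module.finrank V.functionField L = p)
    (h : ∀ v : V, ∃ (y : L) (g : V.functionField) (d : ℕ) (t : Fin d → V.presheaf.stalk v),
      y ∉ Set.range (algebraMap V.functionField L) ∧ algebraMap V.functionField L g = y ^ p ∧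
      Ideal.span (Set.range t) = IsLocalRing.maximalIdeal (V.presheaf.stalk v) ∧
      ringKrullDim (V.presheaf.stalk v) = (d : WithBot ℕ∞) ∧
      (∀ D ∈ E, v ∈ D.support → ∃ j, stalkIdeal D v = Ideal.span {t j}) ∧
      ((∃ (m : ℕ) (hmd : m ≤ d) (a : Fin m → ℕ), 0 < m ∧ (∀ i, ¬ p ∣ a i) ∧
          g = ∏ i : Fin m, (algebraMap (V.presheaf.stalk v) V.functionField
            (t (Fin.castLE hmd i))) ^ (a i) ∧
          (m = 1 ∨ ∀ i : Fin m, ∃ D ∈ E, stalkIdeal D v = Ideal.span {t (Fin.castLE hmd i)})) ∨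
       (∃ u₀ : V.presheaf.stalk v, IsUnit u₀ ∧
          g = algebraMap (V.presheaf.stalk v) V.functionField u₀ ∧
          ((∀ c : V.presheaf.stalk v, u₀ - c ^ p ∉ IsLocalRing.maximalIdeal (V.presheaf.stalk v)) ∨
           (∃ (c : V.presheaf.stalk v) (j₀ : Fin d), u₀ - c ^ p = t j₀ ∧
              ∀ D ∈ E, stalkIdeal D v ≠ Ideal.span {t j₀}))))) :
    Scheme.HasResolution (Spec.map (CommRingCat.ofHom (algebraMap V.functionField L)) ≫
        V.fromSpecStalk (genericPoint V)).normalization :=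
  hK _ (hA p hp V hchar E L hV hE hL hdeg h)

/-- **The arithmetic heart of the exceptionalisation game (codimension-2 transversal type).**
Along an original boundary branch of exponent `a ≢ 0` meeting an exceptional divisor of exponent
`e`, the `k`-th blow-up of their (canonical) intersection produces an exceptional divisor of
exponent `e + k a`; some `k < p` kills it. (The general game — rule K of the card — is recorded with
its exhaustive verification in the evidence file `exc2.py`/`RESULTS.md`.) [folklore] -/
theorem exponent_sweep (p : ℕ) [Fact p.Prime] (a e : ZMod p) (ha : a ≠ 0) :
    ∃ k : ℕ, k < p ∧ e + (k : ZMod p) * a = 0 := by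
  sorry

end Summit.ResolutionOfSingularities.ResolutionOfSingularities.Cruxes.CleanModelsSuffice.Ideator2

end
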